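import Literature.NumberTheory.EllipticCurves.IwasawaAlgebraLengthAwayComparisonProofs
import Literature.NumberTheory.EllipticCurves.IwasawaAlgebraSemilinearCharIdealProofs
import Literature.NumberTheory.EllipticCurves.IwasawaAlgebraProofs
import HarnessLib

/-!
# Characteristic ideals of modules killed by a power of a prime element: `ϖ^k · M = 0 ⟹ char M = (ϖ)^n`, and
# `ϖ^k · A ⊆ A′ ⊆ A ⟹ char(N/A′) = (ϖ)^n · char(N/A)` — the algebra of the «`(p)^i` slack»

Generic commutative algebra (everything PROVED, nothing assumed), a corollary of the tree's
`Module.charIdeal_eq_span_pow_mul_finprod_away` (`IwasawaAlgebraLengthAwayComparisonProofs`: over a Noetherian domain with a prime element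
`ϖ`, `char M = (ϖ)^{length M_(ϖ)} · ∏_{ht 𝔮 = 1, ϖ ∉ 𝔮} 𝔮^{length M_𝔮}`) and `Module.lengthAt_eq_zero_of_isTorsionBy` (`IwasawaAlgebraProofs`):

* ★ `Module.exists_charIdeal_eq_span_pow_of_isTorsionBy_pow` — if `ϖ^k` kills the finitely generated module `M` then **`char M = (ϖ)^n`** for some
  `n` (every height-one `𝔮 ∌ ϖ` misses `ϖ^k`, so `M_𝔮 = 0`);
* ★★ `Module.exists_charIdeal_quotient_eq_span_pow_mul_of_smul_le` — for submodules `A′ ≤ A` of `N` with `ϖ^k·A ⊆ A′` and `N/A′` finitely generated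
  torsion: **`char(N/A′) = (ϖ)^n · char(N/A)`** (`char(A/A′)·char(N/A) = char(N/A′)`, the tree's `charIdeal_quotient_mul_charIdeal_quotient_map`);
  hence `Module.exists_charIdeal_quotient_mul_span_pow_eq_of_smul_le`: **`∃ i i′, char(N/A′)·(ϖ)^i = char(N/A)·(ϖ)^{i′}`** — the shape of the
  comparison hypotheses `ha`/`hc` of the cell's M-LINE-PIN (`Summits/…/PrintCf2RubinValueTwoLinePin…`, `∃ i i', char · (2)^i = … · (2)^{i'}`).

WHY (cell `bsd-print-cf2`, width seat `bsd-line-cf2c-w7` g24, brick §4(c), item D4 of `Cruxes/TwoVariableMainConjAtSplitTwoQuad/BRICK-C-ITEMS-g24.md`):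
the two elliptic-unit systems inside `U¹_∞(𝔓)` (Rubin's `𝒞̄`, typed by ty2 / Li–Tian–Yan–Zhu Thm. 7.2, versus de Shalit's `Θ(1; 𝔪, 𝔞) = Θ₀¹²`, used by
the Coleman lane) differ by (i) 12-th = 4-th powers (`ThetaValueOneRubinUnits`, p812995), (ii) `(σ−1)`-differences (invisible:
`PrintCf2RubinValueTwoCharIdealAugmentationInsensitive`, p813804), (iii) lower-tame-conductor units whose classes in the `χ`-coinvariants are
`2`-torsion (`TwistedCoinvariantsFixedVectors`, p813466); (i) and (iii) change two-variable characteristic ideals by a POWER OF `(2)` and by nothing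
else — this file is that statement, for any Noetherian domain and prime element.  `--supports` crux stmt-BirchSwinnertonDyer-24033.  BSD is not
advanced by this file.

References: N. Bourbaki, *Algèbre commutative* VII §4.5 Prop. 10–11; J. Neukirch, A. Schmidt, K. Wingberg, *Cohomology of Number Fields* (2nd ed.)
Ch. V §3 (5.3.9)–(5.3.10), §1 (5.1.4) Remark 1; L. Washington, *Introduction to Cyclotomic Fields* §13.2.
-/

noncomputable section

namespace Literature.NumberTheory.EllipticCurves

namespace Module

variable {R : Type*} [CommRing R] [IsNoetherianRing R] [IsDomain R]
  {M : Type*} [AddCommGroup M] [_root_.Module R M]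
  {N : Type*} [AddCommGroup N] [_root_.Module R N]

/-! ### `ϖ^k · M = 0 ⟹ char M = (ϖ)^n` -/

omit [IsNoetherianRing R] in
/-- A module killed by a non-zero element of a domain is torsion. [cite: BourbakiAC5to7, Ch. VII §4 no. 5] -/
theorem isTorsion_of_isTorsionBy_ne_zero {s : R} (hs : s ≠ 0) (hM : Module.IsTorsionBy R M s) : Module.IsTorsion R M :=
  fun x ↦ ⟨⟨s, mem_nonZeroDivisors_of_ne_zero hs⟩, @hM x⟩

/-- ★ **`char M = (ϖ)^n` for a finitely generated module killed by a power `ϖ^k` of a prime element** (`n = length M_(ϖ)`; every other height-one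
prime `𝔮` misses `ϖ^k`, so `M_𝔮 = 0` and contributes nothing). [cite: NeukirchSchmidtWingberg2008, Ch. V §3 (5.3.9)–(5.3.10), §1 (5.1.4) Remark 1]
[cite: BourbakiAC5to7, Ch. VII §4 no. 5 Prop. 11] -/
theorem exists_charIdeal_eq_span_pow_of_isTorsionBy_pow [Module.Finite R M] {ϖ : R} (hϖ : Prime ϖ) {k : ℕ}
    (hM : Module.IsTorsionBy R M (ϖ ^ k)) : ∃ n : ℕ, charIdeal R M = Ideal.span {ϖ} ^ n := by
  have hϖk : ϖ ^ k ≠ 0 := pow_ne_zero k hϖ.ne_zero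
  refine ⟨(lengthAt R M ⟨Ideal.span {ϖ}, (Ideal.span_singleton_prime hϖ.ne_zero).mpr hϖ⟩).toNat, ?_⟩
  rw [charIdeal_eq_span_pow_mul_finprod_away (isTorsion_of_isTorsionBy_ne_zero hϖk hM) hϖ]
  conv_rhs => rw [← mul_one (Ideal.span {ϖ} ^ _)]
  congr 1
  refine finprod_mem_eq_one_of_forall_eq_one fun 𝔮 h𝔮 ↦ ?_
  have hnot : ϖ ^ k ∉ 𝔮.asIdeal := fun h ↦ h𝔮.2 (𝔮.isPrime.mem_of_pow_mem k h)
  rw [lengthAt_eq_zero_of_isTorsionBy hM 𝔮 hnot, ENat.toNat_zero, pow_zero]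

/-- The same for `k = 1`: a finitely generated module killed by the prime element itself. [cite: BourbakiAC5to7, Ch. VII §4 no. 5 Prop. 11] -/
theorem exists_charIdeal_eq_span_pow_of_isTorsionBy [Module.Finite R M] {ϖ : R} (hϖ : Prime ϖ)
    (hM : Module.IsTorsionBy R M ϖ) : ∃ n : ℕ, charIdeal R M = Ideal.span {ϖ} ^ n :=
  exists_charIdeal_eq_span_pow_of_isTorsionBy_pow hϖ (k := 1) (by rwa [pow_one])

/-! ### `ϖ^k · A ⊆ A′ ⊆ A ⟹ char(N/A′) = (ϖ)^n · char(N/A)` -/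

omit [IsNoetherianRing R] [IsDomain R] in
/-- If `ϖ^k·A ⊆ A′` then the submodule `A ⧸ A′` of `N ⧸ A′` (`A.map A′.mkQ`) is killed by `ϖ^k`. [cite: BourbakiAC5to7, Ch. VII §4 no. 5] -/
theorem isTorsionBy_map_mkQ_of_smul_le (A' A : Submodule R N) {s : R} (h : ∀ a ∈ A, s • a ∈ A') :
    Module.IsTorsionBy R ↥(A.map A'.mkQ) s := by
  rintro ⟨x, hx⟩
  obtain ⟨a, ha, rfl⟩ := Submodule.mem_map.mp hx
  apply Subtype.ext
  rw [Submodule.coe_smul, ← map_smul, Submodule.coe_zero, Submodule.mkQ_apply, Submodule.Quotient.mk_eq_zero]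
  exact h a ha

/-- ★★ **`char(N ⧸ A′) = (ϖ)^n · char(N ⧸ A)` when `A′ ≤ A` and `ϖ^k·A ⊆ A′`** (`N ⧸ A′` finitely generated torsion): `char(A/A′)·char(N/A) = char(N/A′)`
and `char(A/A′) = (ϖ)^n`.  E.g. `A′ = 4·A` (twelfth = fourth powers of a unit system inside a pro-`2` group), or `A/A′` a module of `χ`-coinvariant
classes killed by `2`. [cite: BourbakiAC5to7, Ch. VII §4 no. 5 Prop. 10–11] [cite: NeukirchSchmidtWingberg2008, Ch. V §3 (5.3.9)–(5.3.10)] -/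
theorem exists_charIdeal_quotient_eq_span_pow_mul_of_smul_le (A' A : Submodule R N) (hle : A' ≤ A)
    [Module.Finite R (N ⧸ A')] (hN : Module.IsTorsion R (N ⧸ A')) {ϖ : R} (hϖ : Prime ϖ) {k : ℕ}
    (h : ∀ a ∈ A, ϖ ^ k • a ∈ A') :
    ∃ n : ℕ, charIdeal R (N ⧸ A') = Ideal.span {ϖ} ^ n * charIdeal R (N ⧸ A) := by
  haveI : IsNoetherian R (N ⧸ A') := isNoetherian_of_isNoetherianRing_of_finite R _
  haveI : Module.Finite R ↥(A.map A'.mkQ) := Module.IsNoetherian.finite R _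
  obtain ⟨n, hn⟩ := exists_charIdeal_eq_span_pow_of_isTorsionBy_pow (M := ↥(A.map A'.mkQ)) hϖ (isTorsionBy_map_mkQ_of_smul_le A' A h)
  refine ⟨n, ?_⟩
  rw [← charIdeal_quotient_mul_charIdeal_quotient_map A' A hle hN, hn]

/-- ★★ **The «slack» form `∃ i i′, char(N ⧸ A′)·(ϖ)^i = char(N ⧸ A)·(ϖ)^{i′}`** under the same hypotheses (`i = 0`, `i′ = n`) — the currency of the
cell's comparison binders `ha`/`hc` (`… · (2)^i = … · (2)^{i'}` over `Λ₂ = ℤ₂⟦T₁,T₂⟧`, where `2` is a prime element).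
[cite: BourbakiAC5to7, Ch. VII §4 no. 5 Prop. 10–11] [cite: NeukirchSchmidtWingberg2008, Ch. V §3 (5.3.9)–(5.3.10)] -/
theorem exists_charIdeal_quotient_mul_span_pow_eq_of_smul_le (A' A : Submodule R N) (hle : A' ≤ A)
    [Module.Finite R (N ⧸ A')] (hN : Module.IsTorsion R (N ⧸ A')) {ϖ : R} (hϖ : Prime ϖ) {k : ℕ}
    (h : ∀ a ∈ A, ϖ ^ k • a ∈ A') :
    ∃ i i' : ℕ, charIdeal R (N ⧸ A') * Ideal.span {ϖ} ^ i = charIdeal R (N ⧸ A) * Ideal.span {ϖ} ^ i' := by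
  obtain ⟨n, hn⟩ := exists_charIdeal_quotient_eq_span_pow_mul_of_smul_le A' A hle hN hϖ h
  exact ⟨0, n, by rw [pow_zero, mul_one, hn, mul_comm]⟩

/-- **Sandwich form**: for `A′ ≤ A″ ≤ A` with `ϖ^k·A ⊆ A′`, also `char(N ⧸ A″) = (ϖ)^m · char(N ⧸ A)` for some `m` (apply the theorem to `A″ ≤ A`,
`ϖ^k·A ⊆ A′ ⊆ A″`). [cite: BourbakiAC5to7, Ch. VII §4 no. 5 Prop. 10–11] -/
theorem exists_charIdeal_quotient_eq_span_pow_mul_of_smul_le_of_le (A' A'' A : Submodule R N) (h₁ : A' ≤ A'') (h₂ : A'' ≤ A)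
    [Module.Finite R (N ⧸ A'')] (hN : Module.IsTorsion R (N ⧸ A'')) {ϖ : R} (hϖ : Prime ϖ) {k : ℕ}
    (h : ∀ a ∈ A, ϖ ^ k • a ∈ A') :
    ∃ m : ℕ, charIdeal R (N ⧸ A'') = Ideal.span {ϖ} ^ m * charIdeal R (N ⧸ A) :=
  exists_charIdeal_quotient_eq_span_pow_mul_of_smul_le A'' A h₂ hN hϖ fun a ha ↦ h₁ (h a ha)

end Module

end Literature.NumberTheory.EllipticCurves
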